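import Summits.QuantumFields.YangMills.Theorems.UV3PinnedStepOrganOfMassEnvelopeV3
import Summits.QuantumFields.YangMills.Theorems.UV3PinnedMassEnvelopeV3OfN08
import Summits.QuantumFields.YangMills.Theorems.UV3PinnedStepOrganOfGrowingPartialIterates
import HarnessLib

/-!
# R3 (cell `ym3-torus`, YM₃ on T³ — a ladder RUNG, NOT d = 4, NOT infinite volume, NOT a mass gap, NOT the Clay problem) — **THE ♭-TOLERANCE IN THE REGISTERED (v3)
# CURRENCY: the S organ row (S-ii) and the U top leaf of the 19936 skeleton v4 FROM A `K`-LINEARLY GROWING ENVELOPE OF THE PINNED MASSES `massP`**, hJ♭(v3)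
# «`massP_K(r,·) ≤ e^{A₁ + A₂·K}` a.e.» in place of the registered row `stub_hJ` = hJ(v3) «`massP_K(r,·) ≤ e^{A₁}`»; and hJ♭(v3) FROM THE RUN-LINEAR TOP LETTER hTop♭ (flat)

Seat `ym-ust-19936-w5` g18 (WIDTH-5 helper on stmt-QuantumFields-19936 `HistoryTailL`; NO claim on crux ∕ stub ∕ registry).  THEOREMS ONLY (0 `def`, 0 `sorry`);
`--supports stmt-QuantumFields-19936 --as helper`; count-neutral; CONDITIONAL on the v3 (α) socket `AlphaInputsT3AC.OfV3At F 𝔠 a₀ a₁` and on the displayed row.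

THE POINT.  The registry of record (ideator g17, 2026-08-30T01:59Z; ★★OWNER RECORD 17bi) is `Lines/pinned_stability.lean` v4 with rows `stub_laneRecordsV3` and `stub_hJ` = hJ(v3),
the K-UNIFORM a.e. envelope of the PINNED masses `PinnedStep.massP` (no trivial-history floor in this currency); §1a∕§1b of the skeleton derive the faces' rows from it by
✓`AlphaInputsT3AC.OfV3At.hSii_of_massEnvelope` (w6 g7, S) and ✓`AlphaInputsT3AC.OfV3At.hlf_ae_of_massEnvelope` (w6 g7, U).  The v1 files ✓`UV3PinnedStepOrganOfGrowingMassEnvelope` ∕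
✓`UV3PinnedStepOrganOfGrowingPartialIterates` ∕ ✓`UV3UnitEnvelopeSlackOfMassEnvelope` showed that the (S-ii) row and the history-tail door tolerate a log-envelope LINEAR in the run
length (`β^A` slot, ✓`exp_mul_le_exp_mul_beta_pow`).  THIS FILE transcribes that tolerance to the registered currency:
* §1 ★★★ `AlphaInputsT3AC.OfV3At.hSii_of_growingMassEnvelope` — the v3 (S-ii) binder of ✓`AlphaInputsT3AC.OfV3At.pinnedTop_of_pinnedLF` VERBATIM from hJ♭(v3) (`wtP ≤ massP`,
  ✓`pinnedLF_le_of_massEnvelope_v3` per run at `A₁ + A₂⁺K`, then the β-slot; `A := ⌈A₂⁺m∕log L⌉₊`, `c := 1∕128`);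
* §2 ★★ `AlphaInputsT3AC.OfV3At.hlfExp_ae_of_growingMassEnvelope` — the U top leaf with EXPONENTIAL SLACK `LF_K ≤ e^{A₂K}·e^{CZ}` a.e. (`K ≥ 1`) from hJ♭(v3)
  (✓`all_le_of_massEnvelope_v3` at `max A₁ 0 + A₂⁺K`; `massP(triv) = 1`);
* §3 ★★ `AlphaInputsT3AC.OfV3At.growingMassEnvelope_of_growingTopHaarPushforward` — hJ♭(v3) FROM hTop♭ «`(dU_j)∘(iterFrom (avT3 F K) j n)⁻¹ ≤ e^{c₀ + c₁·K}·dU_{j+n}`, `j + n = K`»,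
  FLAT in v3 (`A₂ := |c₁|`, no `+1`): px8 g12's per-run ✓`UV3StartClosedOfTopHaarPushforward.massRecP_le_exp_ae_of_map_iterFrom_le_top` at `c := max (c₀ + c₁K) 0` — the run-linear
  twin of w6 g7's ✓`AlphaInputsT3AC.OfV3At.hJ_of_topHaarPushforward`;
* §4 `…OfV3At.growingMassEnvelope_of_massEnvelope` (hJ(v3) ⟹ hJ♭(v3), `A₂ := 0`).
The guarded crux face over hJ♭(v3) ∕ hTop♭ in v3 (U face with exponential slack + LEAD's K-24 door) is the companion file `UnitScaleTiltHistoryTailOfPackageV3GrowingMassEnvelope`.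

HONEST SCOPE.  Bookkeeping over landed theorems; hJ♭(v3) ∕ hTop♭ are DISPLAYS, NOT proved (OPEN for `blockAvg ℰp`, the N08 loop part); nothing of `stub_hJ`, `stub_laneRecordsV3`, `hP′`,
`HistoryTailL` (19936), the rung, d = 4, a mass gap or Clay is proved here; no summit statement is proved by this seat.

References: T. Bałaban, Commun. Math. Phys. **102** (1985) 255–275 [Balaban1985UV3] ((2) p.256, (5) p.256, (40)–(41) p.266, (48) p.268, (67)–(71) p.273, pp.273–274); T. Bałaban,
Commun. Math. Phys. **109** (1987) 249–301 [Balaban1987RG1] ((0.11) p.253).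
-/

set_option autoImplicit false

noncomputable section

namespace Summit.QuantumFields.YangMills.Theorems.UV3OrganOfGrowingMassEnvelopeV3

open MeasureTheory
open scoped BigOperators ENNReal
open Literature.MathematicalPhysics.QuantumFieldTheory.Balaban1983to89
open Literature.MathematicalPhysics.QuantumFieldTheory.Balaban1983to89.T3ContinuumYM3Torus
open Literature.MathematicalPhysics.QuantumFieldTheory.Balaban1983to89.T3UnitLawDensityEML (ℰp)
open Literature.MathematicalPhysics.QuantumFieldTheory.Balaban1983to89.T4AvgSensitivity (iterFrom)
open Literature.MathematicalPhysics.QuantumFieldTheory.Balaban1985CMP102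
open Literature.MathematicalPhysics.QuantumFieldTheory.Balaban1985CMP102.Setting
open Summit.QuantumFields.Balaban3D.Carriers
open Summit.QuantumFields.Balaban3D.Proofs.Primitives
open Summit.QuantumFields.Balaban3D.Proofs.GroupModelLieC
open Summit.QuantumFields.Balaban3D.Proofs.TowerAC
open Summit.QuantumFields.Balaban3D.Proofs.StandardAC
open Summit.QuantumFields.Balaban3D.Proofs.InputsAC
open Summit.QuantumFields.Balaban3D.Proofs.MassesPAC
open Summit.QuantumFields.YangMills.Theorems.UV3PinnedStepOrganOfMassEnvelopeV3 (pinnedLF_le_of_massEnvelope_v3)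
open Summit.QuantumFields.YangMills.Theorems.UV3UnitEnvelopeOrganOfMassEnvelopeV3 (all_le_of_massEnvelope_v3)
open Summit.QuantumFields.YangMills.Theorems.UV3PinnedStepOrganOfGrowingMassEnvelope (exp_mul_le_exp_mul_beta_pow)
open Summit.QuantumFields.YangMills.Theorems.UV3PinnedStepOrganOfGrowingPartialIterates (smul_measure_mono max_add_mul_zero_le_abs)
open Summit.QuantumFields.YangMills.Theorems.UV3StartClosedOfTopHaarPushforward (massRecP_le_exp_ae_of_map_iterFrom_le_top)

variable {F : T3Family} {𝔠 : AlphaConsts F.L (suGroupModel 2).N} {a₀ a₁ : ℝ}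

/-! ## §1 The v3 (S-ii) row from hJ♭(v3) -/

open Classical in
/-- ★★★ **THE ORGAN ROW (S-ii) `hSii`(v3) — ✓`AlphaInputsT3AC.OfV3At.pinnedTop_of_pinnedLF`'s binder VERBATIM — FROM THE `K`-LINEARLY GROWING ENVELOPE hJ♭(v3) OF THE
PINNED MASSES.**  Per family, record, v3 socket `h : OfV3At F 𝔠 a₀ a₁`, coupling in the window, depth `m > 0`: IF `∃ A₁ A₂, ∀ K r, Admissible r → r ≠ triv → ∀ᵐ W,
massP_K(r, W) ≤ e^{A₁ + A₂·K}`, THEN `hSii`(v3) with `CZ := A₁ + A₂⁺m + (6∕log L)(2L^m)³ + log(1 + C_coll∕ℓ)`, `A := ⌈A₂⁺m∕log L⌉₊`, `c := 1∕128` — the windowed weights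
`wtP ≤ massP` (✓`PinnedStep.wtP_nonneg_le`), ✓`pinnedLF_le_of_massEnvelope_v3` per run at the envelope `A₁ + A₂⁺·K`, and the β-slot ✓`exp_mul_le_exp_mul_beta_pow` at the
constrained heights.  The registered row hJ(v3) is the case `A₂ = 0` (§4). [cite: Balaban1985UV3, (40)–(41) p.266, (67)–(71) p.273, pp.273–274, (5) p.256, (7) p.257] -/
theorem _root_.Summit.QuantumFields.YangMills.Theorems.AlphaInputsT3AC.OfV3At.hSii_of_growingMassEnvelope (h : AlphaInputsT3AC.OfV3At F 𝔠 a₀ a₁)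
    (hc : 0 < a₀ ∧ 0 < a₁ ∧ 𝔠.B₃ * a₁ ≤ a₀) (γ : ℝ) (hγ : 0 < γ) (hγ1 : γ ≤ (min 𝔠.gamma0 1) ^ 2) {m : ℕ} (hm : 0 < m)
    (hJ : ∃ A₁ A₂ : ℝ, ∀ (K : ℕ) (r : Hist (F.P K) K),
      Hist.Admissible 𝔠.lane.carrier.M₁ (rcolOf (T3Scales F γ hγ (hγ1.trans (sq_min_one_le _ 𝔠.gamma0_pos)) K) 𝔠.lane.carrier) K r →
      r ≠ Hist.triv (F.P K) K →
      ∀ᵐ W ∂(fieldMeasure (F.P K) K (Matrix.specialUnitaryGroup (Fin 2) ℂ)),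
        PinnedStep.massP 𝔠.lane (h.pkgAtV3 hc γ hγ hγ1 K).X K r W ≤ Real.exp (A₁ + A₂ * K)) :
    ∃ (CZ c : ℝ) (A : ℕ), 0 < c ∧
      ∀ (K j : ℕ) (hj1 : 1 ≤ j) (hjK : j + 2 ≤ K), j + (K - 1) / m ≤ K → ∀ (a : Plaq (F.P K) j),
        ∀ᵐ W ∂(fieldMeasure (F.P K) K (Matrix.specialUnitaryGroup (Fin 2) ℂ)),
        ∑ r ∈ Finset.univ.filter (fun r : Hist (F.P K) K =>
            a ∈ r ⟨j, by omega⟩ ∨ ¬ plaqCover a ⊆ Omega 𝔠.lane.carrier.M₁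
              (rcolOf (T3Scales F γ hγ (hγ1.trans (sq_min_one_le _ 𝔠.gamma0_pos)) K) 𝔠.lane.carrier) j
              (fun i : Fin j => r (Fin.castLE (by omega) i)) j),
          (h.pkgAtV3 hc γ hγ hγ1 K).wtP K r W *
            Real.exp (-((h.pkgAtV3 hc γ hγ hγ1 K).T.mainT K r W) + (h.pkgAtV3 hc γ hγ hγ1 K).T.Zterm K r) ≤
        Real.exp CZ * ((F.scheme ℰp γ).β (K - j) ^ A *
          Real.exp (-(c * B10.pFun 𝔠.b₀ 𝔠.p₀ (Real.sqrt (γ * ((F.L : ℝ)⁻¹) ^ (K - j))) ^ 2))) := by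
  obtain ⟨A₁, A₂, hA⟩ := hJ
  set B : ℝ := max A₂ 0 with hB
  have hB0 : 0 ≤ B := le_max_right _ _
  have hAB : A₂ ≤ B := le_max_left _ _
  have hγone : γ ≤ 1 := hγ1.trans ((sq_le_one_iff₀ (le_min 𝔠.gamma0_pos.le zero_le_one)).mpr (min_le_right _ _))
  have hNpos : (0 : ℝ) < ((suGroupModel 2).N : ℝ) := by exact_mod_cast (suGroupModel 2).N_pos
  set X : ℝ := 3 / (Real.log F.L / 2) * (2 * (F.L : ℝ) ^ F.m) ^ 3 +
      Real.log (1 + 9 * (2 * (2 * ((𝔠.lane.carrier.R₁ + 1) * 𝔠.lane.carrier.M₁) +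
        2 * ((F.L : ℝ) * (3 * ((𝔠.lane.carrier.M₁ : ℝ) - 1)) + 3 * ((F.L : ℝ) - 1)) + 15 * F.L + 7) + 6) ^ 3 / (Real.log F.L / 2)) with hX
  refine ⟨A₁ + B * m + X, 1 / (4 * ((suGroupModel 2).N : ℝ)) / 16, ⌈B * m / Real.log F.L⌉₊, by positivity,
    fun K j hj1 hjK hjm a => ?_⟩
  -- the windowed weights under the envelope of run `K` (monotone in `A₂ ↦ B`), gathered over the finitely many histories
  have hae : ∀ᵐ W ∂(fieldMeasure (F.P K) K (Matrix.specialUnitaryGroup (Fin 2) ℂ)), ∀ r : Hist (F.P K) K,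
      Hist.Admissible 𝔠.lane.carrier.M₁ (rcolOf (T3Scales F γ hγ (hγ1.trans (sq_min_one_le _ 𝔠.gamma0_pos)) K) 𝔠.lane.carrier) K r →
      r ≠ Hist.triv (F.P K) K → (h.pkgAtV3 hc γ hγ hγ1 K).wtP K r W ≤ Real.exp (A₁ + B * K) := by
    refine ae_all_iff.2 fun r => ?_
    have hwt : ∀ W, (h.pkgAtV3 hc γ hγ hγ1 K).wtP K r W ≤ PinnedStep.massP 𝔠.lane (h.pkgAtV3 hc γ hγ hγ1 K).X K r W := fun W =>
      (PinnedStep.wtP_nonneg_le 𝔠.lane (h.pkgAtV3 hc γ hγ hγ1 K).X (AlphaInputsT3AC.admWindowT3 F 𝔠 γ hγ hγ1 K) K r W).2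
    by_cases hadm : Hist.Admissible 𝔠.lane.carrier.M₁
      (rcolOf (T3Scales F γ hγ (hγ1.trans (sq_min_one_le _ 𝔠.gamma0_pos)) K) 𝔠.lane.carrier) K r
    · by_cases hne : r = Hist.triv (F.P K) K
      · exact Filter.Eventually.of_forall fun W _ h2 => absurd hne h2
      · filter_upwards [hA K r hadm hne] with W hW
        intro _ _
        refine ((hwt W).trans hW).trans (Real.exp_le_exp.mpr ?_)
        have := mul_le_mul_of_nonneg_right hAB (Nat.cast_nonneg K)
        linarith
    · exact Filter.Eventually.of_forall fun W h1 _ => absurd h1 hadm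
  filter_upwards [hae] with W hW
  have h1 := pinnedLF_le_of_massEnvelope_v3 (h.pkgAtV3 hc γ hγ hγ1 K) (by omega) a W hW
  refine h1.trans ?_
  have hβ := exp_mul_le_exp_mul_beta_pow F hγ hγone hm hB0 (K := K) (j := j) hjm
  have e1 : A₁ + B * K + 3 / (Real.log F.L / 2) * (2 * (F.L : ℝ) ^ F.m) ^ 3 +
      Real.log (1 + 9 * (2 * (2 * ((𝔠.lane.carrier.R₁ + 1) * 𝔠.lane.carrier.M₁) +
        2 * ((F.L : ℝ) * (3 * ((𝔠.lane.carrier.M₁ : ℝ) - 1)) + 3 * ((F.L : ℝ) - 1)) + 15 * F.L + 7) + 6) ^ 3 / (Real.log F.L / 2)) =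
      (A₁ + X) + B * K := by rw [hX]; ring
  rw [e1, show A₁ + B * m + X = (A₁ + X) + B * m by ring]
  set E : ℝ := Real.exp (-(1 / (4 * ((suGroupModel 2).N : ℝ)) / 16 *
    B10.pFun 𝔠.b₀ 𝔠.p₀ (Real.sqrt (γ * ((F.L : ℝ)⁻¹) ^ (K - j))) ^ 2)) with hE
  have hE0 : 0 ≤ E := (Real.exp_pos _).le
  calc Real.exp ((A₁ + X) + B * K) * E = Real.exp (A₁ + X) * Real.exp (B * K) * E := by rw [Real.exp_add (A₁ + X)]
    _ ≤ Real.exp (A₁ + X) * (Real.exp (B * m) * (F.scheme ℰp γ).β (K - j) ^ ⌈B * m / Real.log F.L⌉₊) * E :=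
        mul_le_mul_of_nonneg_right (mul_le_mul_of_nonneg_left hβ (Real.exp_pos _).le) hE0
    _ = Real.exp ((A₁ + X) + B * m) * ((F.scheme ℰp γ).β (K - j) ^ ⌈B * m / Real.log F.L⌉₊ * E) := by
        rw [Real.exp_add (A₁ + X)]; ring

/-! ## §2 The v3 U top leaf with exponential slack from hJ♭(v3) -/

/-- ★★ **THE U TOP LEAF WITH EXPONENTIAL SLACK FROM hJ♭(v3)**: `∃ CZ A₂, 0 ≤ A₂ ∧ ∀ K ≥ 1, ∀ᵐ W, LF_K(W)[r ↦ e^{−mainT + Zterm}] ≤ e^{A₂·K}·e^{CZ}` — per run the finitely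
many a.e. envelopes are gathered, `wtP ≤ massP`, `massP(triv) = 1` (✓`massRecP_triv`), so EVERY admissible history has `wtP_K(r,W) ≤ exp(max A₁ 0 + A₂⁺K)`; then
✓`all_le_of_massEnvelope_v3`.  The K-uniform ✓`AlphaInputsT3AC.OfV3At.hlf_ae_of_massEnvelope` is the case `A₂ = 0`. [cite: Balaban1985UV3, (5) p.256, (40)–(41) p.266, (67)–(71) p.273, pp.273–274] -/
theorem _root_.Summit.QuantumFields.YangMills.Theorems.AlphaInputsT3AC.OfV3At.hlfExp_ae_of_growingMassEnvelope (h : AlphaInputsT3AC.OfV3At F 𝔠 a₀ a₁)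
    (hc : 0 < a₀ ∧ 0 < a₁ ∧ 𝔠.B₃ * a₁ ≤ a₀) (γ : ℝ) (hγ : 0 < γ) (hγ1 : γ ≤ (min 𝔠.gamma0 1) ^ 2) (π : AlphaInputsT3AC.PolymerT3 F)
    (hJ : ∃ A₁ A₂ : ℝ, ∀ (K : ℕ) (r : Hist (F.P K) K),
      Hist.Admissible 𝔠.lane.carrier.M₁ (rcolOf (T3Scales F γ hγ (hγ1.trans (sq_min_one_le _ 𝔠.gamma0_pos)) K) 𝔠.lane.carrier) K r →
      r ≠ Hist.triv (F.P K) K →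
      ∀ᵐ W ∂(fieldMeasure (F.P K) K (Matrix.specialUnitaryGroup (Fin 2) ℂ)),
        PinnedStep.massP 𝔠.lane (h.pkgAtV3 hc γ hγ hγ1 K).X K r W ≤ Real.exp (A₁ + A₂ * K)) :
    ∃ (CZ A₂ : ℝ), 0 ≤ A₂ ∧ ∀ (K : ℕ), 1 ≤ K → ∀ᵐ W ∂fieldMeasure (F.P K) K (Matrix.specialUnitaryGroup (Fin 2) ℂ),
      (h.dataT3v3 hc γ hγ hγ1 π).LF K K W
          (fun r => -((h.dataT3v3 hc γ hγ hγ1 π).mainT K K r W) + (h.dataT3v3 hc γ hγ hγ1 π).Zterm K K r) ≤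
        Real.exp (A₂ * K) * Real.exp CZ := by
  obtain ⟨A₁, A₂, hA₁⟩ := hJ
  set B : ℝ := max A₂ 0 with hB
  have hB0 : 0 ≤ B := le_max_right _ _
  have hAB : A₂ ≤ B := le_max_left _ _
  refine ⟨max A₁ 0 + 3 / (Real.log F.L / 2) * (2 * (F.L : ℝ) ^ F.m) ^ 3, B, hB0, fun K _ => ?_⟩
  have hBK : 0 ≤ B * (K : ℝ) := mul_nonneg hB0 (Nat.cast_nonneg K)
  have hae : ∀ᵐ W ∂(fieldMeasure (F.P K) K (Matrix.specialUnitaryGroup (Fin 2) ℂ)), ∀ r : Hist (F.P K) K,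
      Hist.Admissible 𝔠.lane.carrier.M₁ (rcolOf (T3Scales F γ hγ (hγ1.trans (sq_min_one_le _ 𝔠.gamma0_pos)) K) 𝔠.lane.carrier) K r →
      (h.pkgAtV3 hc γ hγ hγ1 K).wtP K r W ≤ Real.exp (max A₁ 0 + B * K) := by
    refine ae_all_iff.2 fun r => ?_
    have hwt : ∀ W, (h.pkgAtV3 hc γ hγ hγ1 K).wtP K r W ≤ PinnedStep.massP 𝔠.lane (h.pkgAtV3 hc γ hγ hγ1 K).X K r W := fun W =>
      (PinnedStep.wtP_nonneg_le 𝔠.lane (h.pkgAtV3 hc γ hγ hγ1 K).X (AlphaInputsT3AC.admWindowT3 F 𝔠 γ hγ hγ1 K) K r W).2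
    by_cases hadm : Hist.Admissible 𝔠.lane.carrier.M₁
      (rcolOf (T3Scales F γ hγ (hγ1.trans (sq_min_one_le _ 𝔠.gamma0_pos)) K) 𝔠.lane.carrier) K r
    · by_cases hne : r = Hist.triv (F.P K) K
      · subst hne
        refine Filter.Eventually.of_forall fun W _ => (hwt W).trans ?_
        rw [show PinnedStep.massP 𝔠.lane (h.pkgAtV3 hc γ hγ hγ1 K).X K (Hist.triv (F.P K) K) W = 1 from massRecP_triv _ _ _ _ _ K W]
        exact Real.one_le_exp (add_nonneg (le_max_right _ _) hBK)
      · filter_upwards [hA₁ K r hadm hne] with W hW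
        intro _
        refine ((hwt W).trans hW).trans (Real.exp_le_exp.mpr ?_)
        have := mul_le_mul_of_nonneg_right hAB (Nat.cast_nonneg K)
        linarith [le_max_left A₁ 0]
    · exact Filter.Eventually.of_forall fun W h1 => absurd h1 hadm
  filter_upwards [hae] with W hW
  have h1 := all_le_of_massEnvelope_v3 (h.pkgAtV3 hc γ hγ hγ1 K) W hW
  calc (h.dataT3v3 hc γ hγ hγ1 π).LF K K W
          (fun r => -((h.dataT3v3 hc γ hγ hγ1 π).mainT K K r W) + (h.dataT3v3 hc γ hγ hγ1 π).Zterm K K r)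
        ≤ Real.exp (max A₁ 0 + B * K) * Real.exp (3 / (Real.log F.L / 2) * (2 * (F.L : ℝ) ^ F.m) ^ 3) := h1
    _ = Real.exp (B * K) * Real.exp (max A₁ 0 + 3 / (Real.log F.L / 2) * (2 * (F.L : ℝ) ^ F.m) ^ 3) := by
        rw [← Real.exp_add, ← Real.exp_add]; ring_nf

/-! ## §3 hJ♭(v3) from the run-linear top letter hTop♭ — flat in the pinned currency -/

/-- ★★ **hJ♭(v3) FOR EVERY HISTORY FROM hTop♭, FLAT**: if at every run `K` every segment of the pinned block averaging `avT3 F K` ending at the unit torus pushes Haar to at most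
`e^{c₀ + c₁·K}`·Haar, then the PINNED masses of every v3 package obey `massP_K(r,·) ≤ e^{|c₀| + |c₁|·K}` `dV_K`-a.e., every history — px8 g12's per-run
✓`massRecP_le_exp_ae_of_map_iterFrom_le_top` at `c := max (c₀ + c₁K) 0` (no trivial-history floor in v3, so no `K + 1`; `massP` IS `massRecP` along `avT3 F K`, `XT3_av`).
[cite: Balaban1985UV3, (41) p.266 + (48) p.268 + (2) p.256; Balaban1987RG1, (0.11) p.253] -/
theorem massP_le_exp_ae_of_growingTopHaarPushforward (F : T3Family) (𝔠 : AlphaConsts F.L (suGroupModel 2).N) (γ : ℝ) (hγ : 0 < γ)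
    (hγ1 : γ ≤ (min 𝔠.gamma0 1) ^ 2)
    (hTop : ∃ c₀ c₁ : ℝ, ∀ (K j n : ℕ), j + n = K →
      (fieldMeasure (F.P K) j (Matrix.specialUnitaryGroup (Fin 2) ℂ)).map (iterFrom (avT3 F K) j n) ≤
        ENNReal.ofReal (Real.exp (c₀ + c₁ * (K : ℝ))) • fieldMeasure (F.P K) (j + n) (Matrix.specialUnitaryGroup (Fin 2) ℂ)) :
    ∃ A₁ A₂ : ℝ, ∀ (K : ℕ) (p : AlphaInputsT3AC.PkgAtV3 F 𝔠 γ hγ hγ1 K) (r : Hist (F.P K) K),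
      ∀ᵐ W ∂(fieldMeasure (F.P K) K (Matrix.specialUnitaryGroup (Fin 2) ℂ)), PinnedStep.massP 𝔠.lane p.X K r W ≤ Real.exp (A₁ + A₂ * K) := by
  obtain ⟨c₀, c₁, hcT⟩ := hTop
  refine ⟨|c₀|, |c₁|, fun K p r => ?_⟩
  set cK : ℝ := max (c₀ + c₁ * (K : ℝ)) 0 with hcK
  have hcK0 : 0 ≤ cK := le_max_right _ _
  have hbound : ∀ j n : ℕ, j + n = K →
      (fieldMeasure (F.P K) j (Matrix.specialUnitaryGroup (Fin 2) ℂ)).map (iterFrom (avT3 F K) j n) ≤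
        ENNReal.ofReal (Real.exp cK) • fieldMeasure (F.P K) (j + n) (Matrix.specialUnitaryGroup (Fin 2) ℂ) :=
    fun j n hjn => (hcT K j n hjn).trans
      (smul_measure_mono (ENNReal.ofReal_le_ofReal (Real.exp_le_exp.mpr (le_max_left _ _))) _)
  have key : ∀ᵐ W ∂(fieldMeasure (F.P K) K (Matrix.specialUnitaryGroup (Fin 2) ℂ)), PinnedStep.massP 𝔠.lane p.X K r W ≤ Real.exp cK :=
    massRecP_le_exp_ae_of_map_iterFrom_le_top (avT3 F K) (avgAC_avT3 F K) _ _ _ _ K cK hcK0 hbound r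
  filter_upwards [key] with W hW
  refine hW.trans (Real.exp_le_exp.mpr ?_)
  exact max_add_mul_zero_le_abs c₀ c₁ K

/-- ★★ **hJ♭(v3) AT ITS DISPLAY LETTER FROM hTop♭** (admissible non-trivial histories of the chosen package `h.pkgAtV3 hc γ hγ hγ1 K`) — the run-linear twin of w6 g7's
✓`AlphaInputsT3AC.OfV3At.hJ_of_topHaarPushforward`. [cite: Balaban1985UV3, (41) p.266 + (2) p.256; Balaban1987RG1, (0.11) p.253] -/
theorem _root_.Summit.QuantumFields.YangMills.Theorems.AlphaInputsT3AC.OfV3At.growingMassEnvelope_of_growingTopHaarPushforward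
    (h : AlphaInputsT3AC.OfV3At F 𝔠 a₀ a₁) (hc : 0 < a₀ ∧ 0 < a₁ ∧ 𝔠.B₃ * a₁ ≤ a₀) (γ : ℝ) (hγ : 0 < γ) (hγ1 : γ ≤ (min 𝔠.gamma0 1) ^ 2)
    (hTop : ∃ c₀ c₁ : ℝ, ∀ (K j n : ℕ), j + n = K →
      (fieldMeasure (F.P K) j (Matrix.specialUnitaryGroup (Fin 2) ℂ)).map (iterFrom (avT3 F K) j n) ≤
        ENNReal.ofReal (Real.exp (c₀ + c₁ * (K : ℝ))) • fieldMeasure (F.P K) (j + n) (Matrix.specialUnitaryGroup (Fin 2) ℂ)) :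
    ∃ A₁ A₂ : ℝ, ∀ (K : ℕ) (r : Hist (F.P K) K),
      Hist.Admissible 𝔠.lane.carrier.M₁ (rcolOf (T3Scales F γ hγ (hγ1.trans (sq_min_one_le _ 𝔠.gamma0_pos)) K) 𝔠.lane.carrier) K r →
      r ≠ Hist.triv (F.P K) K →
      ∀ᵐ W ∂(fieldMeasure (F.P K) K (Matrix.specialUnitaryGroup (Fin 2) ℂ)),
        PinnedStep.massP 𝔠.lane (h.pkgAtV3 hc γ hγ hγ1 K).X K r W ≤ Real.exp (A₁ + A₂ * K) := by
  obtain ⟨A₁, A₂, hA⟩ := massP_le_exp_ae_of_growingTopHaarPushforward F 𝔠 γ hγ hγ1 hTop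
  exact ⟨A₁, A₂, fun K r _ _ => hA K (h.pkgAtV3 hc γ hγ hγ1 K) r⟩

/-! ## §4 Monotonicity record: the registered hJ(v3) implies hJ♭(v3) -/

/-- **hJ(v3) ⟹ hJ♭(v3)** (`A₂ := 0`): the registered row `stub_hJ` of skeleton v4 implies the relaxed row — the new display is WEAKER. [folklore] -/
theorem _root_.Summit.QuantumFields.YangMills.Theorems.AlphaInputsT3AC.OfV3At.growingMassEnvelope_of_massEnvelope
    (h : AlphaInputsT3AC.OfV3At F 𝔠 a₀ a₁) (hc : 0 < a₀ ∧ 0 < a₁ ∧ 𝔠.B₃ * a₁ ≤ a₀) (γ : ℝ) (hγ : 0 < γ) (hγ1 : γ ≤ (min 𝔠.gamma0 1) ^ 2)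
    (hJ : ∃ A₁ : ℝ, ∀ (K : ℕ) (r : Hist (F.P K) K),
      Hist.Admissible 𝔠.lane.carrier.M₁ (rcolOf (T3Scales F γ hγ (hγ1.trans (sq_min_one_le _ 𝔠.gamma0_pos)) K) 𝔠.lane.carrier) K r →
      r ≠ Hist.triv (F.P K) K →
      ∀ᵐ W ∂(fieldMeasure (F.P K) K (Matrix.specialUnitaryGroup (Fin 2) ℂ)),
        PinnedStep.massP 𝔠.lane (h.pkgAtV3 hc γ hγ hγ1 K).X K r W ≤ Real.exp A₁) :
    ∃ A₁ A₂ : ℝ, ∀ (K : ℕ) (r : Hist (F.P K) K),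
      Hist.Admissible 𝔠.lane.carrier.M₁ (rcolOf (T3Scales F γ hγ (hγ1.trans (sq_min_one_le _ 𝔠.gamma0_pos)) K) 𝔠.lane.carrier) K r →
      r ≠ Hist.triv (F.P K) K →
      ∀ᵐ W ∂(fieldMeasure (F.P K) K (Matrix.specialUnitaryGroup (Fin 2) ℂ)),
        PinnedStep.massP 𝔠.lane (h.pkgAtV3 hc γ hγ hγ1 K).X K r W ≤ Real.exp (A₁ + A₂ * K) := by
  obtain ⟨A₁, hA⟩ := hJ
  refine ⟨A₁, 0, fun K r hadm hne => ?_⟩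
  filter_upwards [hA K r hadm hne] with W hW
  rwa [zero_mul, add_zero]

end Summit.QuantumFields.YangMills.Theorems.UV3OrganOfGrowingMassEnvelopeV3

end
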